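import Mathlib
import Summits.QuantumFields.BalabanUV.Beta.CoarseCoerciveCovariantEnergy

/-!
# `Summit.QuantumFields.BalabanUV.Beta.CoarseCoerciveTransportPair` — E-I3 FOR A BACKGROUND FIELD WITH TWO TRANSPORTS: the
# covariant block average `q = covFamily s R` (print's (3.19): scalar weights × the RECURSIVE contour transports `R` of
# [13] (3.55)) paired with a quasi-reconstruction `r = covFamily t R̃` carrying a DIFFERENT transport `R̃` (e.g. straight
# fine contours): the mass matrix is block-diagonal with fibre blocks `Σ_x t_y(x)s_y(x)·R̃_y(x)R_y(x)ᵀ`, coercive with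
# constant `(1 − ε)δ` when the loops «R̃-contour there, R-contour back» have holonomy defect `≤ ε`; the energy side is the
# row owner's `energy_superpose_covFamily_le` for `R̃` VERBATIM; hence `((1−ε)δ)²∕(μS₁S₂ + θ₁′θ₂′)·‖B‖² ≤ Re B*(QA⁻¹Q*)B`
# (cell topic `Summits/QuantumFields/BalabanUV/Beta`; row-D4 interface item (I3), E-I3; the REPAIR of this unit's finding
# on NOTE-I3 §5.2 (e2), journal l.15742)

HONEST FRAMING (page 1 of everything in this cell).  Discharging `FlowStep.BetaPertH` would make Bałaban's ultraviolet
stability UNCONDITIONAL — a constructive-QFT result; NOT the continuum limit, NOT the Clay problem.  This module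
discharges nothing of `BetaPertH`; [folklore] finite-dimensional linear algebra, kernel-checked (unit `b2b-balaban-beta-d4-p3`,
road P3, gen 6).  WHY (this unit's HEADS-UP l.15742, NOTE `HOME/b2b-balaban-beta-d4-p3/g6/NOTE-EI3-contour-loops.md`): the
row owner's `CoarseCoerciveCovariantEnergy.coarse_coercive_cov` (p221805) takes the SAME transport `R` in the average and in
the bump; with print's recursive contours ([13] (3.55) p. 401: the chain through the centres of the 1-, 2-, …, (j−1)-blocks
containing x) the loops seen by the bump's covariant derivative across an l-face have area ≍ L^{2l+1} plaquettes, so under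
(3.35) their defect is ≍ α₀L^{2l+1−2j} — NOT the thin O(α₀L^{−j}) — and the same-transport bump's energy exceeds the U = 1
count by a factor ≍ 1 + c·n·α₀² (n = L^j), not uniform in j.  Decoupling the bump's transport (`R̃`: straight contours, thin
neighbour loops, energy = U = 1 count × (1 + O(α₀))²) from the average's (`R`, fixed by print) costs only a fibre defect `ε`
in the mass matrix (loop «straight there, recursive back», area ≤ C·n², defect O(α₀) uniformly in j) — this module is that
bookkeeping.  Nothing of Bałaban's operators is instantiated (which `R`, `R̃`, `h`, `ε` is O.2's business: (3.35) + an
area-law Stokes bound + two elementary area counts); NO class change on any GAPS row (G-B9-15 decomposed, not closed);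
readiness width 0 unchanged; NOT summit progress.
HONEST DEPENDENCY: continuum YM on T⁴ ⇐ BetaPertH ∧ nine spine estimates (0/9 proved); BetaPertH ⇐
(D1) ∧ (D4) ∧ CAP+tail; G-an2-4 gates asym, D1 and NE2/3/4.

CITATION (locator only; nothing printed is used as a hypothesis).  [13] = T. Bałaban, *Propagators for lattice gauge
theories in a background field*, Commun. Math. Phys. **99**, 389–434 (1985) [Balaban1985BackgroundPropagators], (3.19)
p. 393 (the covariant average and its contour transports), (3.35) p. 396 (regularity), (3.55) p. 401 (the recursive
structure of `Γ^{(j)}_{y,x}` — render READ AS IMAGE by this seat 2026-08-20), (3.132) p. 422.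

CONTENTS (0 sorry).  §1 `fibreMass` (the fibre block `Σ_x t_y(x)s_y(x)·R̃_y(x)R_y(x)ᵀ`), **`massMatrix_covFamily₂`**
(disjoint block supports ⟹ the mass matrix of `(covFamily t R̃, covFamily s R)` is `[y = y′]·fibreMass y`),
**`massCoercive_covFamily₂`** (fibrewise coercivity `c` of the blocks ⟹ mass coercivity `c`).  §2 **`fibreMass_coercive_of_defect`**
(`t s ≥ 0`, `Σ_x t s ≥ δ`, `‖(R̃_y(x)R_y(x)ᵀ − 1)v‖ ≤ ε‖v‖`, `ε ≤ 1` ⟹ `c = (1 − ε)δ`).  §3 **`coarse_coercive_cov₂`** (the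
assembly: the owner's `energy_superpose_covFamily_le` for `R̃` + `sandwich_coercive_of_quasiReconstruction` BY NAME).  §4
`coarse_coercive_cov` is the case `R̃ = R`, `ε = 0` (recorded as a remark, not re-proved).  §5 non-vacuity.
NOT HERE: any instance (contours, (3.35), Stokes); the area counts of the NOTE.  NOT summit progress.
-/

namespace Summit.QuantumFields.BalabanUV.Beta.CoarseCoerciveTransportPair

open scoped BigOperators Matrix ComplexConjugate
open Finset Matrix
open Summit.QuantumFields.BalabanUV.Beta.AccretiveCombesThomasSandwich (sandwich)
open Summit.QuantumFields.BalabanUV.Beta.UnitLatticeResolventWalk (Qm superpose)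
open Summit.QuantumFields.BalabanUV.Beta.CoarseCoerciveQuasiReconstruction (massMatrix star_superpose_dotProduct_eq
  sandwich_coercive_of_quasiReconstruction)
open Summit.QuantumFields.BalabanUV.Beta.CoarseCoerciveTransport (covFamily)
open Summit.QuantumFields.BalabanUV.Beta.CoarseCoerciveCovariantEnergy (l2 l2_sq l2_nonneg cpx cpx_apply cpx_one cpx_sub
  nsq_eq_sum_slice covDiff hol energy_superpose_covFamily_le)
open Literature.MathematicalPhysics.QuantumFieldTheory.Balaban1983to89.B5Prop11Lower (nsq nsq_nonneg star_dotProduct_self)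

noncomputable section

variable {S Cp μ ι : Type*} [Fintype S] [Fintype Cp] [Fintype μ] [Fintype ι] [DecidableEq S] [DecidableEq Cp]
  [DecidableEq μ]

/-! ## §1 The mass matrix with two transports -/

/-- THE FIBRE BLOCK of the mass matrix at block `y`: `Σ_x t_y(x)s_y(x)·R̃_y(x)R_y(x)ᵀ` (real `Cp × Cp` matrix, complexified).
[folklore] -/
def fibreMass (t s : μ → S → ℝ) (Rt R : μ → S → Matrix Cp Cp ℝ) (y : μ) : Matrix Cp Cp ℂ :=
  cpx (∑ x, (t y x * s y x) • (Rt y x * (R y x)ᵀ))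

omit [Fintype μ] [DecidableEq S] [DecidableEq μ] in
/-- Entries of the fibre block. [folklore] -/
theorem fibreMass_apply (t s : μ → S → ℝ) (Rt R : μ → S → Matrix Cp Cp ℝ) (y : μ) (a a' : Cp) :
    fibreMass t s Rt R y a a' = ((∑ x, t y x * s y x * (Rt y x * (R y x)ᵀ) a a' : ℝ) : ℂ) := by
  rw [fibreMass, cpx_apply, Matrix.sum_apply]
  simp only [Matrix.smul_apply, smul_eq_mul]

omit [Fintype μ] [DecidableEq S] in
/-- **THE MASS MATRIX WITH TWO TRANSPORTS**: for scalar profile `t` and average weights `s` with DISJOINT block supports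
(`t_y(x)s_{y′}(x) = 0` for `y ≠ y′`), the mass matrix of `(covFamily t R̃, covFamily s R)` is block-diagonal in the block
index with fibre blocks `fibreMass y` — the transports NO LONGER cancel, they leave the loop `R̃_y(x)R_y(x)ᵀ`.
[cite: Balaban1985BackgroundPropagators, (3.19) p.393] -/
theorem massMatrix_covFamily₂ (t s : μ → S → ℝ) (hdisj : ∀ y y' x, y ≠ y' → t y x * s y' x = 0)
    (Rt R : μ → S → Matrix Cp Cp ℝ) (y : μ) (a : Cp) (y' : μ) (a' : Cp) :
    massMatrix (covFamily t Rt) (covFamily s R) (y, a) (y', a') = if y = y' then fibreMass t s Rt R y a a' else 0 := by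
  rw [massMatrix, Matrix.mul_apply]
  simp only [Qm, Matrix.conjTranspose_apply, covFamily, Complex.star_def, Complex.conj_ofReal]
  rw [Fintype.sum_prod_type]
  simp only [← Complex.ofReal_mul, ← Complex.ofReal_sum]
  by_cases hy : y = y'
  · subst hy
    rw [if_pos rfl, fibreMass_apply]
    congr 1
    refine Finset.sum_congr rfl fun x _ => ?_
    rw [Matrix.mul_apply, Finset.mul_sum]
    exact Finset.sum_congr rfl fun i _ => by rw [Matrix.transpose_apply]; ring
  · rw [if_neg hy]
    norm_cast
    refine Finset.sum_eq_zero fun x _ => Finset.sum_eq_zero fun i _ => ?_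
    have := hdisj y y' x hy
    calc t y x * Rt y x a i * (s y' x * R y' x a' i) = (t y x * s y' x) * (Rt y x a i * R y' x a' i) := by ring
      _ = 0 := by rw [this, zero_mul]

omit [DecidableEq S] in
/-- **MASS COERCIVITY FROM FIBREWISE COERCIVITY OF THE BLOCKS**: if every fibre block satisfies
`c‖v‖² ≤ Re v*(fibreMass y)v`, then `c‖B‖² ≤ Re⟨Σ B·covFamily t R̃, Σ B·covFamily s R⟩` — the hypothesis `hmass` of
`sandwich_coercive_of_quasiReconstruction` with constant `c`. [folklore] -/
theorem massCoercive_covFamily₂ (t s : μ → S → ℝ) (hdisj : ∀ y y' x, y ≠ y' → t y x * s y' x = 0)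
    (Rt R : μ → S → Matrix Cp Cp ℝ) {c : ℝ}
    (hfib : ∀ y (v : Cp → ℂ), c * nsq v ≤ (star v ⬝ᵥ (fibreMass t s Rt R y *ᵥ v)).re) (B : μ × Cp → ℂ) :
    c * nsq B ≤ (star (superpose (covFamily t Rt) B) ⬝ᵥ superpose (covFamily s R) B).re := by
  classical
  have hform : star B ⬝ᵥ (massMatrix (covFamily t Rt) (covFamily s R) *ᵥ B)
      = ∑ y, star (CoarseCoerciveCovariantEnergy.slice B y) ⬝ᵥ
          (fibreMass t s Rt R y *ᵥ CoarseCoerciveCovariantEnergy.slice B y) := by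
    simp only [dotProduct, Matrix.mulVec, Pi.star_apply, CoarseCoerciveCovariantEnergy.slice]
    rw [Fintype.sum_prod_type]
    refine Finset.sum_congr rfl fun y _ => Finset.sum_congr rfl fun a _ => ?_
    congr 1
    rw [Fintype.sum_prod_type, Finset.sum_eq_single y (fun y' _ hy' => ?_) (by simp)]
    · exact Finset.sum_congr rfl fun a' _ => by rw [massMatrix_covFamily₂ t s hdisj Rt R, if_pos rfl]
    · exact Finset.sum_eq_zero fun a' _ => by rw [massMatrix_covFamily₂ t s hdisj Rt R, if_neg (Ne.symm hy'), zero_mul]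
  rw [star_superpose_dotProduct_eq, hform, Complex.re_sum, nsq_eq_sum_slice B, Finset.mul_sum]
  exact Finset.sum_le_sum fun y _ => hfib y (CoarseCoerciveCovariantEnergy.slice B y)

/-! ## §2 Fibrewise coercivity from a holonomy-defect bound -/

/-- The form of one complexified loop: `Re v*(cpx H)v ≥ (1 − ε)‖v‖²` when `‖(cpx H − 1)v‖ ≤ ε‖v‖`. [folklore] -/
theorem re_form_cpx_ge_of_defect (H : Matrix Cp Cp ℝ) {ε : ℝ} (hdef : ∀ v : Cp → ℂ, l2 ((cpx H - 1) *ᵥ v) ≤ ε * l2 v)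
    (v : Cp → ℂ) : (1 - ε) * nsq v ≤ (star v ⬝ᵥ (cpx H *ᵥ v)).re := by
  have hsplit : star v ⬝ᵥ (cpx H *ᵥ v) = star v ⬝ᵥ v + star v ⬝ᵥ ((cpx H - 1) *ᵥ v) := by
    rw [Matrix.sub_mulVec, Matrix.one_mulVec, dotProduct_sub]; ring
  have hcs : |(star v ⬝ᵥ ((cpx H - 1) *ᵥ v)).re| ≤ l2 v * l2 ((cpx H - 1) *ᵥ v) := by
    refine (Complex.abs_re_le_norm _).trans ?_
    have h := norm_inner_le_norm (𝕜 := ℂ) (WithLp.toLp 2 v : EuclideanSpace ℂ Cp)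
      (WithLp.toLp 2 ((cpx H - 1) *ᵥ v) : EuclideanSpace ℂ Cp)
    rw [EuclideanSpace.inner_eq_star_dotProduct] at h
    simpa [l2, dotProduct_comm] using h
  rw [hsplit, Complex.add_re, star_dotProduct_self, Complex.ofReal_re, ← l2_sq]
  have h1 := (abs_le.1 hcs).1
  have h2 : l2 v * l2 ((cpx H - 1) *ᵥ v) ≤ l2 v * (ε * l2 v) := mul_le_mul_of_nonneg_left (hdef v) (l2_nonneg v)
  nlinarith

omit [Fintype μ] [DecidableEq S] [DecidableEq μ] in
/-- **FIBREWISE COERCIVITY FROM THE DEFECT**: `t_y s_y ≥ 0` pointwise, block mass `Σ_x t_y(x)s_y(x) ≥ δ`, and the loops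
`R̃_y(x)R_y(x)ᵀ` (bump contour there, average contour back) within `ε ≤ 1` of the identity in operator norm on the fibre
⟹ every fibre block is coercive with `c = (1 − ε)δ`. [cite: Balaban1985BackgroundPropagators, (3.35) p.396] -/
theorem fibreMass_coercive_of_defect (t s : μ → S → ℝ) (hts : ∀ y x, 0 ≤ t y x * s y x) {δ : ℝ}
    (hδ : ∀ y, δ ≤ ∑ x, t y x * s y x) (Rt R : μ → S → Matrix Cp Cp ℝ) {ε : ℝ} (hε : ε ≤ 1)
    (hdef : ∀ y x (v : Cp → ℂ), l2 ((cpx (Rt y x * (R y x)ᵀ) - 1) *ᵥ v) ≤ ε * l2 v) (y : μ) (v : Cp → ℂ) :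
    (1 - ε) * δ * nsq v ≤ (star v ⬝ᵥ (fibreMass t s Rt R y *ᵥ v)).re := by
  have hexp : star v ⬝ᵥ (fibreMass t s Rt R y *ᵥ v)
      = ∑ x, ((t y x * s y x : ℝ) : ℂ) * (star v ⬝ᵥ (cpx (Rt y x * (R y x)ᵀ) *ᵥ v)) := by
    have hmat : fibreMass t s Rt R y = ∑ x, ((t y x * s y x : ℝ) : ℂ) • cpx (Rt y x * (R y x)ᵀ) := by
      ext a a'
      rw [fibreMass_apply, Matrix.sum_apply]
      push_cast
      exact Finset.sum_congr rfl fun x _ => by rw [Matrix.smul_apply, cpx_apply, smul_eq_mul]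
    rw [hmat, Matrix.sum_mulVec, dotProduct_sum]
    exact Finset.sum_congr rfl fun x _ => by rw [Matrix.smul_mulVec, dotProduct_smul, smul_eq_mul]
  rw [hexp, Complex.re_sum]
  have hterm : ∀ x, t y x * s y x * ((1 - ε) * nsq v)
      ≤ (((t y x * s y x : ℝ) : ℂ) * (star v ⬝ᵥ (cpx (Rt y x * (R y x)ᵀ) *ᵥ v))).re := fun x => by
    rw [Complex.re_ofReal_mul]
    exact mul_le_mul_of_nonneg_left (re_form_cpx_ge_of_defect _ (hdef y x) v) (hts y x)
  calc (1 - ε) * δ * nsq v ≤ (1 - ε) * (∑ x, t y x * s y x) * nsq v := by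
        have := mul_le_mul_of_nonneg_left (hδ y) (sub_nonneg.2 hε)
        nlinarith [nsq_nonneg v]
    _ = ∑ x, t y x * s y x * ((1 - ε) * nsq v) := by
        rw [Finset.mul_sum, Finset.sum_mul]
        exact Finset.sum_congr rfl fun x _ => by ring
    _ ≤ ∑ x, (((t y x * s y x : ℝ) : ℂ) * (star v ⬝ᵥ (cpx (Rt y x * (R y x)ᵀ) *ᵥ v))).re :=
        Finset.sum_le_sum fun x _ => hterm x

/-! ## §3 The assembly with two transports -/

/-- **COARSE COERCIVITY FOR A BACKGROUND FIELD, BUMP TRANSPORT ≠ AVERAGE TRANSPORT.**  Fine form `A` on `S × Cp`: Hermitian,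
invertible, `Re`-psd, dominated by the covariant Gram form `μ‖z‖² + ‖D_W z‖²`.  Covariant block average `q = covFamily s R`
(print's (3.19), `R` the recursive contour transports) and quasi-reconstruction `r = covFamily t R̃` (IN-BLOCK scalar profile
`t` × a SECOND transport `R̃`, e.g. straight fine contours): disjoint block supports, `t s ≥ 0`, block mass `≥ δ > 0`, the
mixed loops within `ε < 1` of the identity (`hdef`), `R̃·R̃ᵀ = 1`, `WᵀW = 1`, the U = 1 counting data `S₁, S₂` and the slope
data `θ₁′, θ₂′` inflated by the defect `h` of the THIN loops of `R̃` (`hhol`).  Then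
`(((1−ε)δ)²∕(μS₁S₂ + θ₁′θ₂′))·‖B‖² ≤ Re B*(Q A⁻¹ Q*)B` for every coarse `B`.  Field inputs: `h` (on `R̃`'s loops) and `ε`
(on the mixed loops) — nothing else. [cite: Balaban1985BackgroundPropagators, (3.19) p.393, (3.35) p.396] -/
theorem coarse_coercive_cov₂ (A : Matrix (S × Cp) (S × Cp) ℂ) (hH : A.IsHermitian) (hU : IsUnit A)
    (hpsd : ∀ g : S × Cp → ℂ, 0 ≤ (star g ⬝ᵥ (A *ᵥ g)).re) (src tgt : ι → S) (W : ι → Matrix Cp Cp ℝ)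
    {μ0 : ℝ} (hμ : 0 ≤ μ0)
    (hA : ∀ z : S × Cp → ℂ, (star z ⬝ᵥ (A *ᵥ z)).re ≤ μ0 * nsq z + nsq (covDiff src tgt W *ᵥ z))
    (t s : μ → S → ℝ) (hdisj : ∀ y y' x, y ≠ y' → t y x * s y' x = 0) (hts : ∀ y x, 0 ≤ t y x * s y x)
    (R Rt : μ → S → Matrix Cp Cp ℝ) (hRt : ∀ y x, Rt y x * (Rt y x)ᵀ = 1) (hW : ∀ b, (W b)ᵀ * W b = 1)
    {δ ε : ℝ} (hδ0 : 0 < δ) (hδ : ∀ y, δ ≤ ∑ x, t y x * s y x) (hε : ε < 1)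
    (hdef : ∀ y x (v : Cp → ℂ), l2 ((cpx (Rt y x * (R y x)ᵀ) - 1) *ᵥ v) ≤ ε * l2 v)
    (h : ι → μ → ℝ) (hh : ∀ b y, 0 ≤ h b y)
    (hhol : ∀ b y v, l2 (cpx (hol src tgt W Rt b y - 1) *ᵥ v) ≤ h b y * l2 v) {S₁ S₂ θ₁ θ₂ : ℝ} (hS0 : 0 ≤ S₁)
    (hS₁ : ∀ x, ∑ y, |t y x| ≤ S₁) (hS₂ : ∀ y, ∑ x, |t y x| ≤ S₂) (hθ0 : 0 ≤ θ₁)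
    (hθ₁ : ∀ b, ∑ y, (|t y (tgt b) - t y (src b)| + |t y (src b)| * h b y) ≤ θ₁)
    (hθ₂ : ∀ y, ∑ b, (|t y (tgt b) - t y (src b)| + |t y (src b)| * h b y) ≤ θ₂)
    (hE : 0 < μ0 * (S₁ * S₂) + θ₁ * θ₂) (B : μ × Cp → ℂ) :
    ((1 - ε) * δ) ^ 2 / (μ0 * (S₁ * S₂) + θ₁ * θ₂) * nsq B ≤ (star B ⬝ᵥ (sandwich A (covFamily s R) *ᵥ B)).re :=
  sandwich_coercive_of_quasiReconstruction A hH hU hpsd (covFamily s R) (covFamily t Rt)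
    (mul_pos (sub_pos.2 hε) hδ0) hE
    (massCoercive_covFamily₂ t s hdisj Rt R (fibreMass_coercive_of_defect t s hts hδ Rt R hε.le hdef))
    (energy_superpose_covFamily_le A src tgt W hμ hA t Rt hRt hW h hh hhol hS0 hS₁ hS₂ hθ0 hθ₁ hθ₂) B

/-! ## §4 Remark: the same-transport case

With `R̃ = R` and `R·Rᵀ = 1` the mixed loops are trivial (`ε = 0`) and `coarse_coercive_cov₂` is the owner's
`CoarseCoerciveCovariantEnergy.coarse_coercive_cov` (p221805) — not re-proved here.  The point of the two-transport form is
that `h` is then measured on the loops of `R̃` (thin for straight contours) instead of on the loops of print's recursive `R`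
(fat across sub-block faces, NOTE `HOME/b2b-balaban-beta-d4-p3/g6/NOTE-EI3-contour-loops.md`). -/

/-! ## §5 Non-vacuity -/

/-- One site, one block, trivial fibre, no bonds (`ι` empty): `t = s = 1`, `R = R̃ = 1`, `A = 2`, `δ = 1`, `ε = 0`, `S₁ = S₂ = 1`,
`θ₁′ = θ₂′ = 0`, `μ = 2`: the hypotheses are jointly satisfiable and the bound reads `(1·1)²∕(2·1 + 0)·‖B‖² ≤ Re B*(Q A⁻¹ Q*)B`
(= ½‖B‖², tight). [folklore] -/
example (B : Unit × Unit → ℂ) :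
    ((1 - 0) * 1) ^ 2 / (2 * (1 * 1) + 0 * 0) * nsq B ≤
      (star B ⬝ᵥ (sandwich ((2 : ℂ) • (1 : Matrix (Unit × Unit) (Unit × Unit) ℂ))
        (covFamily (fun (_ : Unit) (_ : Unit) => (1 : ℝ)) fun _ _ => (1 : Matrix Unit Unit ℝ)) *ᵥ B)).re := by
  have hA2 : ((2 : ℂ) • (1 : Matrix (Unit × Unit) (Unit × Unit) ℂ)).IsHermitian := by
    rw [Matrix.IsHermitian, Matrix.conjTranspose_smul, Matrix.conjTranspose_one]
    norm_num
  have hform : ∀ z : Unit × Unit → ℂ, star z ⬝ᵥ (((2 : ℂ) • (1 : Matrix (Unit × Unit) (Unit × Unit) ℂ)) *ᵥ z)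
      = (((2 * nsq z : ℝ)) : ℂ) := fun z => by
    rw [Matrix.smul_mulVec, Matrix.one_mulVec, dotProduct_smul, star_dotProduct_self, smul_eq_mul]
    push_cast; ring
  refine coarse_coercive_cov₂ (ι := Empty) _ hA2
    ((Matrix.isUnit_iff_isUnit_det _).2 (by simp))
    (fun g => by rw [hform, Complex.ofReal_re]; exact mul_nonneg zero_le_two (nsq_nonneg g))
    Empty.elim Empty.elim Empty.elim (μ0 := 2) zero_le_two (fun z => ?_)
    (fun _ _ => 1) (fun _ _ => 1) (fun y y' _ hy => (hy (Subsingleton.elim y y')).elim) (fun _ _ => by norm_num)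
    (fun _ _ => 1) (fun _ _ => 1) (fun _ _ => by simp) (fun b => b.elim) one_pos (fun _ => by simp) zero_lt_one
    (fun y x v => ?_) (fun b => b.elim) (fun b => b.elim) (fun b => b.elim) zero_le_one (fun _ => by simp) (fun _ => by simp)
    le_rfl (fun b => b.elim) (fun _ => by simp) (by norm_num) B
  · rw [hform, Complex.ofReal_re]
    linarith [nsq_nonneg (covDiff (ι := Empty) Empty.elim Empty.elim Empty.elim *ᵥ z)]
  · rw [Matrix.transpose_one, Matrix.mul_one, cpx_one, sub_self, Matrix.zero_mulVec, zero_mul]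
    exact le_of_eq (by rw [l2]; simp)

end

end Summit.QuantumFields.BalabanUV.Beta.CoarseCoerciveTransportPair
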